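import Literature.MathematicalPhysics.QuantumFieldTheory.Balaban1983to89.Node00.Record13SepCoP
import HarnessLib

/-!
# BalabanLadder ∕ UV — Track A's output ONE LINE BEFORE the Stage-0 projection, RE-KEYED to the v1.5 record (`Provisos₁₃SepCoP`, the `CoP` edition — print's `ζ` and print's top domain `Ω₀`)

OS-ASSEMBLY BOOKKEEPING (cell `ym-fleet`, seat `ym-osasm-p1`, director-ym R136 (iii); `--supports stmt-QuantumFields-19351` = the spine crux
`Summit.QuantumFields.YangMills.Theses.BalabanLadder.UV`, binder `hUV` of `BalabanLadder.closes`).  DEFINITIONS ONLY (two `Prop`s, parametric in the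
group rank `N`); nothing of Bałaban's is asserted; COUNT-NEUTRAL.  The `Provisos₁₃SepCoP` twin of `Theorems/BalabanLadderUVRecord13SepDefs.lean` (p502401;
itself the twin of `…UVRecord13Defs.lean` p489475): SAME shapes, tokens re-keyed `Provisos₁₃Sep ↦ Provisos₁₃SepCoP`, `datumOfRecord₁₃Sep ↦ datumOfRecord₁₃SepCoP`,
`IsRecordOfRecord₁₃CSep ↦ IsRecordOfRecord₁₃CSepCoP` (all from `Node00/Record13SepCoP.lean`, v1.5 = FILE 24T p521293, node00-def-T).

WHY.  `Node00/Record13SepCoP.lean` is RECORD 13 v1.5 `CoP` (node00-def-T FILE 24T p521293, sibling of FILE 23 `Node00/Record13CoP.lean` p520810; director-ym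
★★★ LINES №160–№162, typed-statement FINDING №7): RECORD 13 v1.0–v1.4 read «Ω₀ := T_η» at scale 0 in two places print does not — (T) the 𝐓-weight pin
`WtOfRecord₁₃` = 12a `tkWeightsOfRecord` (`ζ_j(Y) = ζ0_j(Y)·χreg_j(Y)`: the retained variables regular on ALL of `Y = Ωᶜ_{j+1}`) and (U) the
background of record `UbgMSCoOfRecord` (node00-def-R FILE 22: a class whose scale-0 (1.7)∕(1.9) clauses range over the whole torus), whereas print
([III] p.246 (1.1), p.248 (1.10)–(1.12), p.255; [15] p.277 (1), p.278 (2)(3)(5)(7)) conditions nothing on `P₀` and works on the top domain `Ω₀ = Ω₁ +`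
one layer of `M₁`-cubes; consequence (dag-n11-d `not_tLaw₁₃_zero`): `¬ TLaw₁₃ θ p 0` at every `θ`.  THE FIX F7 (№160; №162 (y) FINAL) = (a) 12a″
`Node00/TkWeightsOfRecordP.lean` p519608 (`ζ := ζ0`), (b) node00-def-R FILE 22′ `Node00/LargeFieldBackgroundCoPOfRecord.lean` p519921
(`regMSCoPOfRecord ∕ bgMSCoPOfRecord ∕ UbgMSCoPOfRecord` re-ranged to print's top domain `suppDomOfRecord`, old arities kept), (c) FILE 23 + 24T = the
VERBATIM images of the landed v1.4 `Co` ∕ `SepCo` editions (FILE 21 p515035 ∕ 22T p515749; director-ym №152 RULING (β): row `bg` AND the §2 form at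
print's background `U_k(V)`, the minimiser over [6]'s class (1.7) ∧ (1.9)) under KEY-RULE-23 (edition token `CoP`: `₁₃SepCo ↦ ₁₃SepCoP`; statement
shapes and binder lists preserved token for token).  HOLD-ALL (№160 (3) ∕ №162): Track A's rev 20 keys ONCE, on v1.5 — the v1.4 `SepCo` edition is
never keyed on (no `SepCo` station is filed); EDITION FREEZE (№160 (4)): v1.5 is the last record edition before KEY-20.  The Track-A detail route `route-QuantumFields-BalabanUVNodes` re-keys its four live items to the new proviso name at rev 20 (the ⁗ four
stmt-QuantumFields-20289∕20290∕20291∕20292 → aside; four ⁵ items; `closes` re-keyed under the token map `Provisos₁₃Sep ↦ Provisos₁₃SepCoP`, `datumOfRecord₁₃Sep ↦ datumOfRecord₁₃SepCoP`, nothing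
else — plan kit `D67-REV20/glue20.lean`).  This file NAMES the conjunction that re-keyed `closes` holds one line before its Stage-0 projection, in the two currencies in use:

* `UVAtParams13SepCoP N` — θ-keyed: `∀ F, ∃ θ (h : θ.Provisos₁₃SepCoP F N), (ZtUnity ∧ SlotsNondegenerate₁₃) ∧ Admissible ∧ (B) ∧ window(K ≥ 1) ∧ END ∧ NE7`
  at `Node00.datumOfRecord₁₃SepCoP F N θ h`;
* `UVAtRecord13CSepCoP N` — (D, w)-keyed: `∀ F, ∃ D w, Node00.IsRecordOfRecord₁₃CSepCoP F N D w ∧ (B) ∧ window(K ≥ 1) ∧ END ∧ NE7`.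

The kernels (`Theorems/BalabanLadderUVRecord13SepCoP.lean`) prove: the four re-keyed texts (`2 ↦ N`, INLINE) ⇒ `UVAtParams13SepCoP N`; θ ⇒ (D, w); both ⇒ the
Stage-0 text (at `N = 2` the CURRENT body of `BalabanLadder.UV`, owner RULING R27: Stage-0 form kept through R85); the T⁴ apex at the pinned record.
NO BRIDGE from the `Provisos₁₃ ∕ Provisos₁₃Sep`-keyed stations (p489475∕p489689, p502401∕p503162): `Node00/Record13SepCoP.lean` issues none by design
(`IsRecordOfRecord₁₃CSepCoP.toCoP`: ONE bridge out, to FILE 23's core record `IsRecordOfRecord₁₃CCoP`, «and NONE from or to the U_old provisos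
`Provisos₁₃ ∕ Provisos₁₃Sep ∕ Provisos₁₃SepMixed` (their `bg` and datum read `UbgOfRecord₁₃`)» — as in v1.4's header (ρ5): a different background
object, proviso sets and data not comparable).  ROUTE-INDEPENDENT BY DESIGN: no `Theses` import, no module in a route's cone.  HONEST FRAMING: names for HYPOTHESES of a conditional chain (0∕6 spine legs discharged); one finite four-torus programme per
family at fixed ε; NOT infinite volume, NOT OS on ℝ⁴, NOT a mass gap, NOT Clay.
-/

set_option autoImplicit false

namespace Summit.QuantumFields.YangMills.Cruxes.UV.Record13SepCoP

open Literature.MathematicalPhysics.QuantumFieldTheory.Balaban1983to89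
open Literature.MathematicalPhysics.QuantumFieldTheory.Balaban1983to89.T4Continuum

/-- **TRACK A's UV PACKAGE AT THE PINNED STAGE-13 RECORD OF THE v1.5 EDITION (v1.5 `Provisos₁₃SepCoP`, `Node00/Record13SepCoP.lean`), θ-KEYED** (`SU(N)`; the spine's is `N = 2`): on every four-torus family some admissible
Stage-13 parameter tuple `θ` satisfying its displayed provisos `h`, with print's partition of unity and non-degenerate present slots (torus-guarded),
whose datum of record `Node00.datumOfRecord₁₃SepCoP F N θ h` carries [III]'s end statement (B) as printed, the non-vacuity coupling window with `K ≥ 1`,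
endpoint existence of its coupling flow ([I] Thm 2, endpoint half) and the hybrid-NE7 spine under it.  Verbatim the conjunction the detail route's
rev-20 `closes` holds after feeding K1⁵'s record to K2⁵ and K3⁵ and before projecting to Stage 0.  OPEN as a whole; never asserted. -/
def UVAtParams13SepCoP (N : ℕ) [NeZero N] : Prop :=
  ∀ F : T4Family, ∃ (θ : Node00.Stage13Params F N) (h : θ.Provisos₁₃SepCoP F N),
    (θ.ZtUnity F N ∧ θ.SlotsNondegenerate₁₃ F N) ∧ θ.Admissible F N ∧
    B16.EndStatementBPrinted (Node00.datumOfRecord₁₃SepCoP F N θ h).C ∧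
    (∃ γ₁ : ℝ, 0 < γ₁ ∧ ∀ γ : ℝ, 0 < γ → γ ≤ γ₁ →
      ∃ P : B12.RunParams, 1 ≤ P.K ∧ ((Node00.datumOfRecord₁₃SepCoP F N θ h).C P).flow.InInterval γ P.K) ∧
    DagBinding.EndpointExistence (Node00.datumOfRecord₁₃SepCoP F N θ h).C.toB12 ∧
    T4ApexHybrid.HybridNE7Under (Node00.datumOfRecord₁₃SepCoP F N θ h)
      (DagBinding.EndpointExistence (Node00.datumOfRecord₁₃SepCoP F N θ h).C.toB12)

/-- **TRACK A's UV PACKAGE AT A STAGE-13 RECORD-OF-RECORD OF THE v1.5 EDITION (v1.5 `IsRecordOfRecord₁₃CSepCoP`, `Node00/Record13SepCoP.lean`), (D, w)-KEYED** (`SU(N)`): on every four-torus family some finite-ε datum `D` and world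
`w` with `Node00.IsRecordOfRecord₁₃CSepCoP F N D w` («(D, w) is the record, Stage 13»: `D = datumOfRecord₁₃SepCoP θ h` for admissible θ with provisos, `w` bound to
its construction), carrying (B) as printed, the `K ≥ 1` coupling window, endpoint existence and the hybrid-NE7 spine.  Implied by `UVAtParams13SepCoP N`
(the unity ∕ non-degeneracy clause is dropped — the record predicate does not carry it).  OPEN as a whole; never asserted. -/
def UVAtRecord13CSepCoP (N : ℕ) [NeZero N] : Prop :=
  ∀ F : T4Family, ∃ (D : FiniteEpsData F (Matrix.specialUnitaryGroup (Fin N) ℂ)) (w : DagBinding.WorldP),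
    Node00.IsRecordOfRecord₁₃CSepCoP F N D w ∧ B16.EndStatementBPrinted D.C ∧
    (∃ γ₁ : ℝ, 0 < γ₁ ∧ ∀ γ : ℝ, 0 < γ → γ ≤ γ₁ → ∃ P : B12.RunParams, 1 ≤ P.K ∧ (D.C P).flow.InInterval γ P.K) ∧
    DagBinding.EndpointExistence D.C.toB12 ∧
    T4ApexHybrid.HybridNE7Under D (DagBinding.EndpointExistence D.C.toB12)

end Summit.QuantumFields.YangMills.Cruxes.UV.Record13SepCoP
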